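import Mathlib.RingTheory.DedekindDomain.IntegralClosure
import Literature.AlgebraicGeometry.Resolution.FiniteNormalizationCompleteLocalBaseProofs
import Literature.AlgebraicGeometry.Resolution.QuasiExcellentFiniteType
import HarnessLib

/-!
# Route `RadicialJung`, crux `CleanModels` (stmt-ResolutionOfSingularities-15917), line `Sketch` rev 35, stub 6 `stub_cleanProp44` (X44c),
# work plan O8 / L7b, (T1-fact): quasi-excellent domains are N-1 and Japanese (N-2)

Memo `Cruxes/CleanModels/Lines/Sketch-memo-hand2-g8-stubs-5-7.md` §2/§4 (i): the capstone ✓ `exists_pointChain_cleanPermissibleAt_or_pthPower_of_cleanRegAt`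
(p813775) and ✓ `exists_pointChain_cleanPermissibleAt_of_isDefectlessField` (p813508) carry the hypothesis «the valued field
`(Frac 𝒪_{C₀,x₀}, 𝒪_{C₀,x₀})` is defectless».  For a discrete valuation ring `D` this is the finiteness of the integral closure of `D` in
every finite extension of `Frac D` (the tree's Dedekind criterion ✓ `isDefectlessIn_of_finite_integralClosure`, `DefectlessDedekind.lean`),
i.e. «`D` is Japanese», and EGA IV₂ (7.8.3) (vi): quasi-excellent rings are Nagata, in particular Japanese.

This file PROVES, def-free, from the tree's Stacks-10.161.15 machinery (`FiniteNormalizationCompleteLocalBaseProofs.lean`, whose proof of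
EGA IV₂ (7.7.4) uses of its complete local base only that the algebra is a G-ring and J-2):

* `module_finite_integralClosure_fractionRing_of_isQuasiExcellentRing` — **a quasi-excellent domain is N-1**: the integral closure of `B`
  in `Frac B` is a finite `B`-module (Stacks 07QV «quasi-excellent rings are Nagata», N-1 half; EGA IV₂ (7.6.4) + (7.7.2));
* `module_finite_integralClosure_of_isQuasiExcellentRing` — **a quasi-excellent domain is Japanese (N-2)**: for every finite extension
  `L` of `Frac D` the integral closure of `D` in `L` is a finite `D`-module (apply N-1 to the finite sub-`D`-algebra `D[b] ⊆ L` generated by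
  an integral `Frac D`-basis `b` of `L`, which is quasi-excellent with `Frac D[b] = L`, and descend along the finite `D ⊆ D[b]`).

Honest framing: OURS as arranged (textbook facts); nothing here proves resolution in characteristic `p`, X44c, or any case of `CleanModels`.
-/

noncomputable section

set_option linter.dupNamespace false -- mandated namespace of this single-conjunct summit

open IsLocalRing Literature.AlgebraicGeometry.Resolution

namespace Summit.ResolutionOfSingularities.ResolutionOfSingularities.Theorems.RadicialJung.CleanModels

universe u

/-- **A quasi-excellent domain is N-1** (Stacks 07QV, N-1 half; EGA IV₂ (7.6.4) with (7.7.2)): for a domain `B` which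
is a G-ring and J-2, the integral closure of `B` in `Frac B` is a finite `B`-module.  Proof = the globalisation of
`EGAIV2_7_7_4_finiteNormalization_completeLocal_proof` verbatim: the regular locus is an open neighbourhood of the generic point (J-2), giving
`f ≠ 0` with `B_𝔭` normal off `V(f)`, so `fⁿ B' ⊆ B` elementwise; every `B_𝔭` is N-1 (`module_finite_integralClosure_localization_of_isGRing`);
Stacks 10.161.15 (`fg_of_forall_prime_locally_fg`). [cite: StacksProject, Tag 07QV] [cite: StacksProject, Tag 0BI1 (Lemma 10.161.15)]
[cite: EGAIV2, (7.8.3) (vi) with (7.6.4) and (7.7.2)] -/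
theorem module_finite_integralClosure_fractionRing_of_isQuasiExcellentRing (B : Type u) [CommRing B] [IsDomain B]
    (hB : IsQuasiExcellentRing B) : Module.Finite B (integralClosure B (FractionRing B)) := by
  classical
  have hG : IsGRing B := hB.isGRing
  haveI : IsNoetherianRing B := hG.1
  have hJ : IsJ2Ring B := hB.isJ2Ring
  -- an `f ≠ 0` with `B_𝔭` regular (hence normal) off `V(f)`
  have hopen : IsOpen (regularLocus B) := hJ.2 B inferInstance
  let η : PrimeSpectrum B := ⟨⊥, Ideal.isPrime_bot⟩
  have hη : η ∈ regularLocus B := by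
    change IsRegularLocalRing (Localization.AtPrime (⊥ : Ideal B))
    haveI : IsDomain (Localization.AtPrime (⊥ : Ideal B)) :=
      IsLocalization.isDomain_localization (Ideal.primeCompl_le_nonZeroDivisors _)
    have hF : IsField (Localization.AtPrime (⊥ : Ideal B)) := by
      rw [IsLocalRing.isField_iff_maximalIdeal_eq, ← Localization.AtPrime.map_eq_maximalIdeal, Ideal.map_bot]
    letI := hF.toField
    infer_instance
  obtain ⟨s, hs⟩ := (PrimeSpectrum.isOpen_iff _).mp hopen
  have hηs : η ∉ PrimeSpectrum.zeroLocus s := by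
    rw [← hs]; exact fun h => h hη
  obtain ⟨f, hfs, hfη⟩ : ∃ f ∈ s, f ∉ η.asIdeal := by
    simpa [PrimeSpectrum.mem_zeroLocus, Set.subset_def] using hηs
  have hf0 : f ≠ 0 := fun h => hfη (by rw [h]; exact Submodule.zero_mem _)
  have hfreg : ∀ 𝔭 : Ideal B, [𝔭.IsPrime] → f ∉ 𝔭 → IsIntegrallyClosed (Localization.AtPrime 𝔭) := by
    intro 𝔭 _ hf𝔭
    have hmem : (⟨𝔭, inferInstance⟩ : PrimeSpectrum B) ∈ regularLocus B := by
      rw [← compl_compl (regularLocus B), hs]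
      exact fun h => hf𝔭 (h hfs)
    haveI : IsRegularLocalRing (Localization.AtPrime 𝔭) := hmem
    exact isIntegrallyClosed_of_isRegularLocalRing _
  -- globalisation
  let N : Submodule B (FractionRing B) := Subalgebra.toSubmodule (integralClosure B (FractionRing B))
  have hfN : ∀ y ∈ N, ∃ (n : ℕ) (b : B), algebraMap B (FractionRing B) b = f ^ n • y :=
    fun y hy => exists_pow_smul_mem_of_isIntegrallyClosed_localization f hfreg y hy
  have hloc : ∀ 𝔭 : PrimeSpectrum B, ∃ S : Finset (FractionRing B), (S : Set (FractionRing B)) ⊆ N ∧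
      ∀ y ∈ N, ∃ s ∉ 𝔭.asIdeal, s • y ∈ Submodule.span B (S : Set (FractionRing B)) :=
    fun 𝔭 => exists_finset_locally_generates_integralClosure 𝔭.asIdeal
      (module_finite_integralClosure_localization_of_isGRing hG 𝔭.asIdeal)
  exact Module.Finite.iff_fg.mpr (fg_of_forall_prime_locally_fg N hf0 hfN hloc)

/-- N-1 transported to ANY fraction field `K` of the quasi-excellent domain `B` (along `FractionRing B ≃ₐ[B] K`). [cite: StacksProject, Tag 07QV] -/
theorem module_finite_integralClosure_of_isQuasiExcellentRing_of_isFractionRing (B : Type u) [CommRing B] [IsDomain B]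
    (hB : IsQuasiExcellentRing B) (K : Type u) [Field K] [Algebra B K] [IsFractionRing B K] :
    Module.Finite B (integralClosure B K) := by
  let e : FractionRing B ≃ₐ[B] K := FractionRing.algEquiv B K
  haveI := module_finite_integralClosure_fractionRing_of_isQuasiExcellentRing B hB
  have heq : (integralClosure B (FractionRing B)).map (e : FractionRing B →ₐ[B] K) = integralClosure B K :=
    integralClosure_map_algEquiv e
  have e' := Subalgebra.equivMapOfInjective (integralClosure B (FractionRing B)) (e : FractionRing B →ₐ[B] K) e.injective
  rw [heq] at e'
  exact Module.Finite.equiv e'.toLinearEquiv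

/-- **A quasi-excellent domain is Japanese (N-2)** (EGA IV₂ (7.8.3) (vi): (quasi-)excellent ⟹ universally Japanese; Stacks
07QV): for a quasi-excellent domain `D` with fraction field `F` and a finite extension `L/F`, the integral closure of `D` in `L` is a finite
`D`-module.  Proof: pick an `F`-basis `b` of `L` of `D`-integral elements (`FiniteDimensional.exists_is_basis_integral`); `D₁ := D[b] ⊆ L` is a
finite `D`-module, hence of finite type and quasi-excellent (`IsQuasiExcellentRing.of_essFiniteType`, Grothendieck's `Stacks07PV_holds`), a
domain with `Frac D₁ = L`; by N-1 the integral closure of `D₁` in `L` — which contains that of `D` — is finite over `D₁`, hence over `D`, and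
`D` is Noetherian. [cite: EGAIV2, (7.8.3) (vi) with (7.6.4) and (7.7.2)] [cite: StacksProject, Tag 07QV] -/
theorem module_finite_integralClosure_of_isQuasiExcellentRing {D : Type u} [CommRing D] [IsDomain D] (hD : IsQuasiExcellentRing D)
    (F : Type u) [Field F] [Algebra D F] [IsFractionRing D F] (L : Type u) [Field L] [Algebra F L] [Algebra D L] [IsScalarTower D F L]
    [FiniteDimensional F L] : Module.Finite D (integralClosure D L) := by
  classical
  haveI : IsNoetherianRing D := hD.isNoetherianRing
  obtain ⟨s, b, hb⟩ := FiniteDimensional.exists_is_basis_integral D F L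
  -- `D₁ = D[b]`
  let D₁ : Subalgebra D L := Algebra.adjoin D (Set.range b)
  haveI hfin₁ : Module.Finite D D₁ :=
    Algebra.finite_adjoin_of_finite_of_isIntegral (Set.finite_range b) (by rintro _ ⟨i, rfl⟩; exact hb i)
  have hD₁ : IsQuasiExcellentRing D₁ :=
    IsQuasiExcellentRing.of_essFiniteType Stacks07PV_holds hD (Algebra.EssFiniteType.of_finiteType D D₁)
  -- `Frac D₁ = L`
  have hinjDL : Function.Injective (algebraMap D L) := by
    rw [IsScalarTower.algebraMap_eq D F L]
    exact (algebraMap F L).injective.comp (IsFractionRing.injective D F)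
  haveI : FaithfulSMul D₁ L := (faithfulSMul_iff_algebraMap_injective D₁ L).mpr Subtype.val_injective
  haveI : IsFractionRing D₁ L := by
    refine IsFractionRing.of_field (R := D₁) (K := L) fun z => ?_
    -- `z = Σ cᵢ bᵢ`, `cᵢ ∈ F = Frac D`: clear the denominators
    have hz : z ∈ Submodule.span F (Set.range b) := by rw [b.span_eq]; exact Submodule.mem_top
    suffices h : ∀ z ∈ Submodule.span F (Set.range b), ∃ (x : D₁) (d : D), d ≠ 0 ∧ algebraMap D L d * z = (x : L) by
      obtain ⟨x, d, hd0, hx⟩ := h z hz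
      refine ⟨x, algebraMap D D₁ d, ?_⟩
      have hd0' : algebraMap D L d ≠ 0 := (map_ne_zero_iff _ hinjDL).mpr hd0
      have h1 : algebraMap D₁ L (algebraMap D D₁ d) = algebraMap D L d := (IsScalarTower.algebraMap_apply D D₁ L d).symm
      have h2 : algebraMap D₁ L x = (x : L) := rfl
      rw [h1, h2, eq_div_iff hd0', ← hx, mul_comm]
    intro z hz
    refine Submodule.span_induction ?_ ?_ ?_ ?_ hz
    · rintro _ ⟨i, rfl⟩
      exact ⟨⟨b i, Algebra.subset_adjoin ⟨i, rfl⟩⟩, 1, one_ne_zero, by simp⟩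
    · exact ⟨0, 1, one_ne_zero, by simp⟩
    · rintro z₁ z₂ - - ⟨x₁, d₁, hd₁, h₁⟩ ⟨x₂, d₂, hd₂, h₂⟩
      refine ⟨algebraMap D D₁ d₂ * x₁ + algebraMap D D₁ d₁ * x₂, d₁ * d₂, mul_ne_zero hd₁ hd₂, ?_⟩
      simp only [map_mul, Subalgebra.coe_add, Subalgebra.coe_mul, Subalgebra.coe_algebraMap, ← h₁, ← h₂]
      ring
    · rintro c z - ⟨x, d, hd, hx⟩
      obtain ⟨a, t, ht, rfl⟩ := IsFractionRing.div_surjective (A := D) c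
      have ht0 : (t : D) ≠ 0 := nonZeroDivisors.ne_zero ht
      refine ⟨algebraMap D D₁ a * x, t * d, mul_ne_zero ht0 hd, ?_⟩
      have htL : algebraMap D L t ≠ 0 := (map_ne_zero_iff _ hinjDL).mpr ht0
      simp only [map_mul, Subalgebra.coe_mul, Subalgebra.coe_algebraMap, ← hx, Algebra.smul_def, map_div₀,
        ← IsScalarTower.algebraMap_apply D F L]
      field_simp
  -- N-1 for `D₁`
  haveI hN1 : Module.Finite D₁ (integralClosure D₁ L) :=
    module_finite_integralClosure_of_isQuasiExcellentRing_of_isFractionRing D₁ hD₁ L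
  haveI : Module.Finite D (integralClosure D₁ L) := Module.Finite.trans D₁ (integralClosure D₁ L)
  -- the integral closure of `D` embeds `D`-linearly into that of `D₁`
  let f : integralClosure D L →ₗ[D] integralClosure D₁ L :=
    { toFun := fun x => ⟨x.1, IsIntegral.tower_top (A := D₁) x.2⟩
      map_add' := fun _ _ => rfl
      map_smul' := fun d x => Subtype.ext (by simp) }
  have hf : Function.Injective f := fun x y hxy => Subtype.ext (congrArg (fun z : integralClosure D₁ L => (z : L)) hxy)
  exact Module.Finite.of_injective f hf

end Summit.ResolutionOfSingularities.ResolutionOfSingularities.Theorems.RadicialJung.CleanModels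

end
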